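import Literature.NumberTheory.Transcendental.SixExponentialsSeveralVariablesSteps
import Literature.NumberTheory.Transcendental.SixExponentialsSeveralVariablesProp61Proofs
import Literature.NumberTheory.Transcendental.TorusZeroEstimate
import Mathlib.Analysis.SpecialFunctions.Pow.Real
import HarnessLib

/-!
# Waldschmidt 1981, Théorème 4.1 (Masser's zero estimate) from Philippon's zero estimate on `𝔾ₘ^d`

Topic `Literature/NumberTheory/Transcendental`; sibling proof file of
`SixExponentialsSeveralVariablesSteps.lean`, which vendors **Théorème 4.1** of [Waldschmidt1981]
(p. 105; = [Masser1981, Theorem 2]) as the named fact `Waldschmidt1981.thm_4_1`: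

> "Soit `P ∈ ℂ[T₁, …, T_d]` un polynôme non nul de degré total au plus `D`, avec `D ≥ 1`. Soit
> `N` un entier positif. Si la fonction `Φ(z) = P(e^{⟨x₁,z⟩}, …, e^{⟨x_d,z⟩})` vérifie
> `Φ(y) = 0` pour tout `y ∈ Y_N`, alors `D ≥ (N/d)^{χ(Y,X)}`."

Masser's own proof ([Masser1981] §§2–6: ranks of prime ideals and of their stabilisers under
commuting affine automorphisms of `ℂ[x₁, …, x_n]`) is a piece of commutative algebra the library
does not have. The tree, however, already vendors the later and stronger zero estimate of
Philippon on the torus (`Literature.NumberTheory.Transcendental.Philippon1986_zeroEstimate_torus`,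
`TorusZeroEstimate.lean`: Nesterenko–Philippon (eds.), LNM 1752, Ch. 11, Thm 4.1 for `G = 𝔾ₘ^d`,
`W = 0`, `T = 0`), and the same chapter prints the deduction of the Masser-type statement from it
(**Corollary 4.2 and the closing remark on `𝔾ₘⁿ`, pp. 221–222**: "`D ≥ c'(S/d)^μ` … in the case
where `G` is the group `𝔾ₘⁿ` … the above corollary holds with `c' = 1` … `μ(Γ; G)` … (see also
[Mas2])"). This file PROVES that deduction in the tree's vocabulary:

`thm_4_1_of_zeroEstimate_torus : Philippon1986_zeroEstimate_torus → thm_4_1`,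

so that the named fact `thm_4_1` carries no debt of its own: its discharge is
`thm_4_1_of_zeroEstimate_torus Philippon1986_zeroEstimate_torus_holds` once the torus zero
estimate is proved (the `d = 1` case of the latter is `Philippon1986_zeroEstimate_torus_one`).

## The printed argument (LNM 1752, Ch. 11, proof of Cor. 4.2, p. 222) and its rendering

With `M = [N/d]`, the set `Σ = exp(Y_M) ⊂ (ℂˣ)^d` (images `(e^{⟨xᵢ,y⟩})ᵢ` of the points of `Y_M`;
`e ∈ Σ`) satisfies `Σ(d) ⊆ exp(Y_{dM}) ⊆ exp(Y_N)`, so `P` vanishes on `Σ(d)` and the zero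
estimate yields a saturated subgroup `A ≠ 0` of `ℤ^d` (the connected algebraic subgroup
`H_A ≠ G`) with `Card((Σ·H_A)/H_A) · D^{d − rank A} ≤ D^d`, i.e. `Card((Σ·H_A)/H_A) ≤ D^{rank A}`.
Put `X' = {∑ aᵢxᵢ ; a ∈ A} ≤ X` (rank `r = rank A ≥ 1`, the `xᵢ` being independent) and
`Y' = {v ∈ Y ; ⟨X', v⟩ ⊆ 2iπℤ}` (rank `λ`); then `⟨X', Y'⟩ ⊆ 2iπℤ`, so `χ(Y, X) ≤ (ℓ − λ)/r`, and two
points of `Y` have the same image modulo `H_A` iff their difference lies in `Y'`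
(`exp⟨∑ aᵢxᵢ, w⟩ = χ_a(exp w)`). "The points of `Σ` of the form `s₁γ₁ + ⋯ + s_λγ_λ` … have
distinct images in `G/H₀`": among the `yⱼ` there are `ℓ − λ` whose integer combinations meet `Y'`
only in `0` (a basis of `ℚ^ℓ/ℚ·Y'` extracted from the images of the coordinate vectors,
`exists_coord_complement`), whence `(M + 1)^{ℓ−λ} ≤ Card((Σ·H_A)/H_A) ≤ D^r` and
`(N/d)^χ ≤ (M+1)^χ ≤ (M+1)^{(ℓ−λ)/r} ≤ D`.

## References

* [Waldschmidt1981] M. Waldschmidt, *Transcendance et exponentielles en plusieurs variables*,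
  Invent. Math. 63 (1981) 97–127, §4 Théorème 4.1 (p. 105) (GDZ scan PPN356556735_0063, LOG_0012).
* [Masser1981] D. W. Masser, *On polynomials and exponential polynomials in several complex
  variables*, Invent. Math. 63 (1981) 81–95, Theorem 2 (pp. 82–83).
* [NesterenkoPhilippon2001] Yu. V. Nesterenko, P. Philippon (eds.), *Introduction to Algebraic
  Independence Theory*, LNM 1752, Springer 2001, Ch. 11 (D. Roy), Theorem 4.1 (p. 218),
  Corollary 4.2 and the remark on `𝔾ₘⁿ` (pp. 221–222).
* [Philippon1986] P. Philippon, *Lemmes de zéros dans les groupes algébriques commutatifs*,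
  Bull. Soc. Math. France 114 (1986) 355–383, Théorème 2.1.
-/

noncomputable section

open Complex Matrix Module

namespace Literature.NumberTheory.Transcendental.Waldschmidt1981

/-! ### Two elementary lemmas -/

/-- A finite sum whose terms vanish off the range of an injection `a` is the sum over `a`.
[folklore] -/
theorem sum_eq_sum_comp_of_injective {κ ι M : Type*} [Fintype κ] [Fintype ι] [AddCommMonoid M]
    {a : κ → ι} (ha : Function.Injective a) {f : ι → M} (hf : ∀ j, (¬ ∃ k, a k = j) → f j = 0) :
    ∑ j, f j = ∑ k, f (a k) := by
  classical
  rw [← Finset.sum_image (s := Finset.univ) (g := a) (f := f) (fun k _ k' _ h => ha h)]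
  refine (Finset.sum_subset (Finset.subset_univ _) fun j _ hj => hf j ?_).symm
  simpa [Finset.mem_image] using hj

/-- `b^{p/r} ≤ D` from `b^p ≤ D^r` (`b, D ≥ 0`, `r > 0`). [folklore] -/
theorem rpow_div_le_of_pow_le {b D : ℝ} {p r : ℕ} (hb : 0 ≤ b) (hD : 0 ≤ D) (hr : 1 ≤ r)
    (h : b ^ p ≤ D ^ r) : b ^ ((p : ℝ) / r) ≤ D := by
  have hr' : (0 : ℝ) < r := by exact_mod_cast hr
  rw [← Real.rpow_le_rpow_iff (Real.rpow_nonneg hb _) hD hr', ← Real.rpow_mul hb,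
    div_mul_cancel₀ _ hr'.ne', Real.rpow_natCast, Real.rpow_natCast]
  exact h

/-! ### Coordinate directions complementary to a subgroup of `ℤ^ℓ` -/

/-- **Independent generators modulo a subgroup.** For a subgroup `B` of `ℤ^ℓ` there are
`ℓ − rank B` (at least) coordinate directions `a : κ ↪ Fin ℓ` such that an integer vector supported
on these directions lies in `B` only if it vanishes. (A basis of `ℚ^ℓ/ℚB` extracted from the
images of the coordinate vectors; this is "`γ₁, …, γ_λ` have linearly independent images in
`G/H₀`" in the proof of [NesterenkoPhilippon2001, Ch. 11 Cor. 4.2, p. 222].) [folklore] -/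
theorem exists_coord_complement (l : ℕ) (B : Submodule ℤ (Fin l → ℤ)) :
    ∃ (κ : Type) (_ : Fintype κ) (a : κ → Fin l), Function.Injective a ∧
      l ≤ Fintype.card κ + Module.finrank ℤ B ∧
      ∀ c ∈ B, (∀ j, (¬ ∃ k, a k = j) → c j = 0) → ∀ k, c (a k) = 0 := by
  classical
  -- integer vectors as rational vectors
  let ι : (Fin l → ℤ) →ₗ[ℤ] (Fin l → ℚ) :=
    ((Int.castRingHom ℚ).compLeft (Fin l)).toAddMonoidHom.toIntLinearMap
  have hι : ∀ v j, ι v j = (v j : ℚ) := fun v j => rfl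
  -- a `ℤ`-basis of `B` and the `ℚ`-span `U` of its image
  obtain ⟨k, bB⟩ := Submodule.basisOfPid (Pi.basisFun ℤ (Fin l)) B
  have hk : Module.finrank ℤ B = k := by
    rw [Module.finrank_eq_card_basis bB, Fintype.card_fin]
  let u : Fin k → Fin l → ℚ := fun t => ι (bB t)
  set U : Submodule ℚ (Fin l → ℚ) := Submodule.span ℚ (Set.range u) with hUdef
  have hUk : Module.finrank ℚ U ≤ k := by
    have h := finrank_range_le_card (R := ℚ) u
    rw [Fintype.card_fin] at h
    exact h
  have hBU : ∀ c ∈ B, ι c ∈ U := by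
    intro c hc
    have h1 : (⟨c, hc⟩ : B) ∈ Submodule.span ℤ (Set.range bB) := bB.mem_span _
    have h2 : c ∈ Submodule.span ℤ (Set.range fun t => (bB t : Fin l → ℤ)) := by
      have h := Submodule.mem_map_of_mem (f := B.subtype) h1
      rw [Submodule.map_span, ← Set.range_comp] at h
      exact h
    have h3 : ι c ∈ Submodule.span ℤ (Set.range u) := by
      have h := Submodule.mem_map_of_mem (f := ι) h2
      rw [Submodule.map_span, ← Set.range_comp] at h
      exact h
    exact Submodule.span_le_restrictScalars ℤ ℚ _ h3
  -- a basis of `ℚ^ℓ / U` among the images of the coordinate vectors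
  let e : Fin l → (Fin l → ℚ) ⧸ U := fun j => U.mkQ (Pi.single j 1)
  have hvec : ∀ v : Fin l → ℚ, v = ∑ j, v j • (Pi.single j (1 : ℚ) : Fin l → ℚ) := by
    intro v
    ext i
    simp [Finset.sum_apply, Pi.single_apply]
  have htop : Submodule.span ℚ (Set.range e) = ⊤ := by
    rw [eq_top_iff]
    rintro q -
    obtain ⟨v, rfl⟩ := U.mkQ_surjective q
    rw [hvec v, map_sum]
    exact Submodule.sum_mem _ fun j _ => by
      rw [map_smul]
      exact Submodule.smul_mem _ _ (Submodule.subset_span ⟨j, rfl⟩)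
  obtain ⟨κ, a, ha, hspan, hli⟩ := exists_linearIndependent' ℚ e
  haveI : Fintype κ := Fintype.ofInjective a ha
  have hcardκ : Fintype.card κ = Module.finrank ℚ ((Fin l → ℚ) ⧸ U) := by
    have h := finrank_span_eq_card (R := ℚ) hli
    rw [hspan, htop, finrank_top] at h
    exact h.symm
  have hquot := Submodule.finrank_quotient_add_finrank U
  rw [Module.finrank_fin_fun] at hquot
  refine ⟨κ, inferInstance, a, ha, by omega, ?_⟩
  intro c hc hsupp
  have h0 : U.mkQ (ι c) = 0 := by
    rw [Submodule.mkQ_apply, Submodule.Quotient.mk_eq_zero]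
    exact hBU c hc
  have hιc : ι c = ∑ j, (c j : ℚ) • (Pi.single j (1 : ℚ) : Fin l → ℚ) := by
    conv_lhs => rw [hvec (ι c)]
    rfl
  have hsum : ∑ j, (c j : ℚ) • e j = 0 := by
    rw [hιc, map_sum] at h0
    simpa only [map_smul] using h0
  have hsum' : ∑ k', (c (a k') : ℚ) • e (a k') = 0 := by
    rw [← hsum]
    exact (sum_eq_sum_comp_of_injective ha (f := fun j => (c j : ℚ) • e j)
      fun j hj => by rw [hsupp j hj, Int.cast_zero, zero_smul]).symm
  intro k'
  have h := Fintype.linearIndependent_iff.mp hli (fun k' => (c (a k') : ℚ)) hsum' k'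
  exact_mod_cast h

/-! ### The exponential map `ℂⁿ → (ℂˣ)^d` attached to `x₁, …, x_d` -/

section ExpTorus

variable {n d : ℕ} {x : Fin d → Fin n → ℂ} {E : (Fin n → ℂ) → Torus d}

/-- The map `E : z ↦ (e^{⟨x₁,z⟩}, …, e^{⟨x_d,z⟩}) ∈ (ℂˣ)^d` (the point
`(1 : e^{⟨x₁,z⟩} : ⋯ : e^{⟨x_d,z⟩})` of `𝔾ₘ^d`, [NesterenkoPhilippon2001, Ch. 11, remark after
Cor. 4.2, p. 222]) exists; below it is only used through this characterisation. [folklore] -/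
theorem exists_expTorus (x : Fin d → Fin n → ℂ) :
    ∃ E : (Fin n → ℂ) → Torus d, ∀ z i, ((E z i : ℂˣ) : ℂ) = cexp (x i ⬝ᵥ z) :=
  ⟨fun z i => Units.mk0 (cexp (x i ⬝ᵥ z)) (Complex.exp_ne_zero _), fun _ _ => rfl⟩

/-- `E 0 = 1`. [folklore] -/
theorem expTorus_zero (hE : ∀ z i, ((E z i : ℂˣ) : ℂ) = cexp (x i ⬝ᵥ z)) : E 0 = 1 := by
  funext i
  ext
  rw [hE]
  simp

/-- `E` is additive. [folklore] -/
theorem expTorus_add (hE : ∀ z i, ((E z i : ℂˣ) : ℂ) = cexp (x i ⬝ᵥ z)) (z z' : Fin n → ℂ) :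
    E (z + z') = E z * E z' := by
  funext i
  ext
  rw [Pi.mul_apply, Units.val_mul, hE, hE, hE, dotProduct_add, Complex.exp_add]

/-- `E (z' − z) = (E z)⁻¹ · E z'`. [folklore] -/
theorem expTorus_sub (hE : ∀ z i, ((E z i : ℂˣ) : ℂ) = cexp (x i ⬝ᵥ z)) (z z' : Fin n → ℂ) :
    E (z' - z) = (E z)⁻¹ * E z' := by
  rw [eq_inv_mul_iff_mul_eq, ← expTorus_add hE, add_sub_cancel]

/-- `E` of a finite sum is the product. [folklore] -/
theorem expTorus_sum (hE : ∀ z i, ((E z i : ℂˣ) : ℂ) = cexp (x i ⬝ᵥ z)) {ι : Type*}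
    (s : Finset ι) (z : ι → Fin n → ℂ) : E (∑ k ∈ s, z k) = ∏ k ∈ s, E (z k) := by
  classical
  induction s using Finset.induction_on with
  | empty => simp [expTorus_zero hE]
  | insert a s ha ih => rw [Finset.sum_insert ha, Finset.prod_insert ha, expTorus_add hE, ih]

/-- **Characters of `𝔾ₘ^d` along `E`**: `χ_a(E z) = e^{⟨∑ aᵢxᵢ, z⟩}`. [folklore] -/
theorem char_expTorus_val (hE : ∀ z i, ((E z i : ℂˣ) : ℂ) = cexp (x i ⬝ᵥ z)) (a : Fin d → ℤ)
    (z : Fin n → ℂ) :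
    ((Torus.char a (E z) : ℂˣ) : ℂ) = cexp (Fintype.linearCombination ℤ x a ⬝ᵥ z) := by
  rw [Torus.char_apply, Units.coe_prod, Fintype.linearCombination_apply]
  simp_rw [← Int.cast_smul_eq_zsmul ℂ]
  rw [sum_smul_dotProduct, Complex.exp_sum]
  refine Finset.prod_congr rfl fun i _ => ?_
  rw [Units.val_zpow_eq_zpow_val, Complex.exp_int_mul, hE]

/-- **`E z ∈ H_A` iff `⟨∑ aᵢxᵢ, z⟩ ∈ 2iπℤ` for all `a ∈ A`.** [folklore] -/
theorem expTorus_mem_subtorus_iff (hE : ∀ z i, ((E z i : ℂˣ) : ℂ) = cexp (x i ⬝ᵥ z))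
    (A : AddSubgroup (Fin d → ℤ)) (z : Fin n → ℂ) :
    E z ∈ Torus.subtorus A ↔
      ∀ a ∈ A, ∃ k : ℤ, Fintype.linearCombination ℤ x a ⬝ᵥ z = 2 * Real.pi * I * k := by
  simp only [Torus.mem_subtorus]
  refine forall₂_congr fun a _ => ?_
  rw [← Units.val_eq_one, char_expTorus_val hE, Complex.exp_eq_one_iff]
  constructor
  · rintro ⟨k, hk⟩
    exact ⟨k, by rw [hk]; ring⟩
  · rintro ⟨k, hk⟩
    exact ⟨k, by rw [hk]; ring⟩

end ExpTorus

/-! ### The largest `Y' ≤ Y` with `⟨X', Y'⟩ ⊆ 2iπℤ` -/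

/-- `{v ∈ Y ; ⟨u, v⟩ ∈ 2iπℤ for all u ∈ X'}` is a subgroup of `Y` — the largest `Y' ≤ Y` with
`⟨X', Y'⟩ ⊆ 2iπℤ` (the subgroup `Γ ∩ H₀` pulled back to `Y`, in the notation of
[NesterenkoPhilippon2001, Ch. 11 Cor. 4.2]); stated as an existence so that this proof file
introduces no definition. [folklore] -/
theorem exists_annTwoPiI {n : ℕ} (X' Y : Submodule ℤ (Fin n → ℂ)) :
    ∃ Y' : Submodule ℤ (Fin n → ℂ), ∀ v, v ∈ Y' ↔
      (v ∈ Y ∧ ∀ u ∈ X', ∃ k : ℤ, u ⬝ᵥ v = 2 * Real.pi * I * k) :=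
  ⟨{ carrier := {v | v ∈ Y ∧ ∀ u ∈ X', ∃ k : ℤ, u ⬝ᵥ v = 2 * Real.pi * I * k}
     zero_mem' := ⟨Y.zero_mem, fun u _ => ⟨0, by simp⟩⟩
     add_mem' := by
       rintro v w ⟨hv, hv'⟩ ⟨hw, hw'⟩
       refine ⟨Y.add_mem hv hw, fun u hu => ?_⟩
       obtain ⟨k, hk⟩ := hv' u hu
       obtain ⟨k', hk'⟩ := hw' u hu
       exact ⟨k + k', by rw [dotProduct_add, hk, hk']; push_cast; ring⟩
     smul_mem' := by
       rintro c v ⟨hv, hv'⟩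
       refine ⟨Y.smul_mem c hv, fun u hu => ?_⟩
       obtain ⟨k, hk⟩ := hv' u hu
       exact ⟨c * k, by rw [dotProduct_smul, hk, zsmul_eq_mul]; push_cast; ring⟩ },
    fun _ => Iff.rfl⟩

/-! ### Théorème 4.1 from the zero estimate on the torus -/

/-- **Théorème 4.1 of [Waldschmidt1981] (= [Masser1981, Theorem 2]) from Philippon's zero
estimate on `𝔾ₘ^d`**, by the argument printed in [NesterenkoPhilippon2001, Ch. 11, Cor. 4.2 and
the remark on `𝔾ₘⁿ`, pp. 221–222] (see the module docstring): if `P ≠ 0` of total degree `≤ D`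
(`D ≥ 1`) vanishes at `(e^{⟨xᵢ,y⟩})ᵢ` for all `y ∈ Y_N` (`N ≥ 1`), then `D ≥ (N/d)^{χ(Y,X)}`.
[cite: Waldschmidt1981, §4 Théorème 4.1 (p. 105)]
[cite: NesterenkoPhilippon2001, Ch. 11 Cor. 4.2 + remark pp. 221–222] -/
theorem thm_4_1_of_zeroEstimate_torus (hZ : Philippon1986_zeroEstimate_torus) : thm_4_1 := by
  intro n d l x y hx hy P D N hP hdeg hD hN hvan
  classical
  set X : Submodule ℤ (Fin n → ℂ) := Submodule.span ℤ (Set.range x) with hXdef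
  set Y : Submodule ℤ (Fin n → ℂ) := Submodule.span ℤ (Set.range y) with hYdef
  have hD1 : (1 : ℝ) ≤ D := by exact_mod_cast hD
  -- `d = 0`: `(N/0)^χ = 0^χ ≤ 1 ≤ D`
  rcases Nat.eq_zero_or_pos d with rfl | hd
  · simp only [Nat.cast_zero, div_zero]
    exact (Real.zero_rpow_le_one _).trans hD1
  -- `d ≥ 1`; `M = [N/d]`; the map `E = exp` into the torus
  set M : ℕ := N / d with hMdef
  obtain ⟨E, hE⟩ := exists_expTorus x
  -- the points `∑ mⱼ yⱼ` of `Y` and the set `Σ = exp(Y_M) ⊂ (ℂˣ)^d`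
  let pt : (Fin l → ℕ) → (Fin n → ℂ) := fun m => ∑ j, ((m j : ℕ) : ℂ) • y j
  have pt_mem : ∀ m, pt m ∈ Y := fun m =>
    Submodule.sum_mem _ fun j _ => by
      rw [Nat.cast_smul_eq_nsmul]
      exact nsmul_mem (Submodule.subset_span (Set.mem_range_self j)) _
  set Box : Set (Fin l → ℕ) := {m | ∀ j, m j ∈ Set.Iic M} with hBoxdef
  have hBox : Box.Finite := Set.Finite.pi' fun _ => Set.finite_Iic M
  set S : Set (Torus d) := (fun m => E (pt m)) '' Box with hSdef
  have hSfin : S.Finite := hBox.image _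
  have h1S : (1 : Torus d) ∈ S := by
    refine ⟨0, fun j => Set.mem_Iic.mpr (Nat.zero_le _), ?_⟩
    show E (pt 0) = 1
    have h0 : pt 0 = 0 := by simp [pt]
    rw [h0, expTorus_zero hE]
  -- `P` vanishes on `Σ(d) ⊆ exp(Y_{dM}) ⊆ exp(Y_N)`
  have hvanS : ∀ g ∈ Torus.prodSet S d, Torus.aevalAt P g = 0 := by
    rintro g ⟨σ, hσ, rfl⟩
    choose m hmBox hmσ using hσ
    have hprod : ∏ k, σ k = E (pt fun j => ∑ k, m k j) := by
      have h1 : ∏ k, σ k = ∏ k, E (pt (m k)) :=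
        Finset.prod_congr rfl fun k _ => (hmσ k).symm
      rw [h1, ← expTorus_sum hE]
      congr 1
      simp only [pt]
      rw [Finset.sum_comm]
      refine Finset.sum_congr rfl fun j _ => ?_
      rw [← Finset.sum_smul, Nat.cast_sum]
    rw [hprod]
    show MvPolynomial.eval (fun i => ((E (pt fun j => ∑ k, m k j) i : ℂˣ) : ℂ)) P = 0
    have hval : (fun i => ((E (pt fun j => ∑ k, m k j) i : ℂˣ) : ℂ)) =
        fun i => cexp (x i ⬝ᵥ pt fun j => ∑ k, m k j) := funext fun i => hE _ i
    rw [hval]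
    refine hvan (fun j => ∑ k, m k j) fun j => ?_
    calc ∑ k, m k j ≤ ∑ _k : Fin d, M := Finset.sum_le_sum fun k _ => Set.mem_Iic.mp (hmBox k j)
      _ = d * M := by simp
      _ ≤ N := Nat.mul_div_le N d
  -- the zero estimate: a subgroup `A ≠ 0` of `ℤ^d` with `Card((Σ·H_A)/H_A) · D^{d - rank A} ≤ D^d`
  obtain ⟨A, hA0, -, hcard, -⟩ := hZ d hd S P D hSfin h1S hP hdeg hvanS
  set A' : Submodule ℤ (Fin d → ℤ) := AddSubgroup.toIntSubmodule A with hA'def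
  set r : ℕ := Module.finrank ℤ A' with hrdef
  have hrd : r ≤ d := by
    have h := Submodule.finrank_le A'
    rwa [Module.finrank_fin_fun] at h
  obtain ⟨a₀, ha₀A, ha₀0⟩ := (A.bot_or_exists_ne_zero).resolve_left hA0
  have hA'ne : A' ≠ ⊥ := by
    intro h
    have : a₀ ∈ A' := ha₀A
    rw [h, Submodule.mem_bot] at this
    exact ha₀0 this
  have hr1 : 1 ≤ r := Nat.one_le_iff_ne_zero.mpr fun h => hA'ne (Submodule.finrank_eq_zero.mp h)
  have hncard : Set.ncard ((QuotientGroup.mk : Torus d → Torus d ⧸ Torus.subtorus A) '' S) ≤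
      D ^ r := by
    have hpos : 0 < D ^ (d - r) := pow_pos hD _
    apply Nat.le_of_mul_le_mul_right _ hpos
    calc Set.ncard ((QuotientGroup.mk : Torus d → Torus d ⧸ Torus.subtorus A) '' S) * D ^ (d - r)
        ≤ D ^ d := hcard
      _ = D ^ r * D ^ (d - r) := by rw [← pow_add, Nat.add_sub_cancel' hrd]
  -- `X' = {∑ aᵢ xᵢ ; a ∈ A}` and `Y' = {v ∈ Y ; ⟨X', v⟩ ⊆ 2iπℤ}`
  let φ : (Fin d → ℤ) →ₗ[ℤ] (Fin n → ℂ) := Fintype.linearCombination ℤ x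
  have hφ : Function.Injective φ := hx.fintypeLinearCombination_injective
  set X' : Submodule ℤ (Fin n → ℂ) := A'.map φ with hX'def
  obtain ⟨Y', hY'mem⟩ := exists_annTwoPiI X' Y
  have hX'X : X' ≤ X := by
    rw [hXdef, ← Fintype.range_linearCombination ℤ x]
    exact LinearMap.map_le_range
  have hX'ne : X' ≠ ⊥ := by
    intro h
    have hmem : φ a₀ ∈ X' := Submodule.mem_map_of_mem (show a₀ ∈ A' from ha₀A)
    rw [h, Submodule.mem_bot, ← map_zero φ] at hmem
    exact ha₀0 (hφ hmem)
  have hfinX' : Module.finrank ℤ X' = r :=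
    (LinearEquiv.finrank_eq (Submodule.equivMapOfInjective φ hφ A')).symm
  have hY'Y : Y' ≤ Y := fun v hv => ((hY'mem v).mp hv).1
  have hpair : PairingInTwoPiIZ X' Y' := fun u hu v hv => ((hY'mem v).mp hv).2 u hu
  have hYfg : Y.FG := Submodule.fg_span (Set.finite_range y)
  haveI : Module.Finite ℤ Y := Module.Finite.iff_fg.mpr hYfg
  haveI : Module.Finite ℤ Y' := finite_of_le_fg hYfg hY'Y
  haveI : Module.Finite ℤ X := Module.Finite.iff_fg.mpr (Submodule.fg_span (Set.finite_range x))
  have hfinY : Module.finrank ℤ Y = l := by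
    rw [hYdef, finrank_span_eq_card hy, Fintype.card_fin]
  have hfinX : Module.finrank ℤ X = d := by
    rw [hXdef, finrank_span_eq_card hx, Fintype.card_fin]
  set lam : ℕ := Module.finrank ℤ Y' with hlamdef
  have hlaml : lam ≤ l := by
    have h := Submodule.finrank_mono hY'Y
    rwa [hfinY] at h
  -- `χ(Y, X) ≤ (ℓ − λ)/r`
  have hchi : chi X Y ≤ ((l : ℚ) - lam) / r := by
    have h := chi_le_masserQuot hX'X hY'Y hX'ne hpair
      (by rw [hfinX, hfinX']; exact hrd) (by rw [hfinY]; exact hlaml)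
    rw [masserQuot, hfinY, hfinX'] at h
    exact h
  -- two points of `Y` are congruent modulo `H_A` iff their difference lies in `Y'`: counting
  let ψ : (Fin l → ℤ) →ₗ[ℤ] (Fin n → ℂ) := Fintype.linearCombination ℤ y
  have hψ : Function.Injective ψ := hy.fintypeLinearCombination_injective
  set B : Submodule ℤ (Fin l → ℤ) := Y'.comap ψ with hBdef
  have hBlam : Module.finrank ℤ B ≤ lam := by
    rw [LinearEquiv.finrank_eq (Submodule.equivMapOfInjective ψ hψ B)]
    exact Submodule.finrank_mono (Submodule.map_comap_le ψ Y')
  obtain ⟨κ, instκ, a, ha, hcardκ, hsep⟩ := exists_coord_complement l B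
  -- the sub-box in the directions `a` injects into `(Σ·H_A)/H_A`
  let ext : (κ → Fin (M + 1)) → (Fin l → ℕ) := fun m => Function.extend a (fun k => (m k : ℕ)) 0
  have hext_apply : ∀ m k, ext m (a k) = (m k : ℕ) := fun m k => ha.extend_apply _ _ _
  have hext_off : ∀ m j, (¬ ∃ k, a k = j) → ext m j = 0 := fun m j hj => by
    simp only [ext]
    rw [Function.extend_apply' _ _ _ hj]
    rfl
  have hextBox : ∀ m, ext m ∈ Box := by
    intro m j
    rw [Set.mem_Iic]
    by_cases hj : ∃ k, a k = j
    · obtain ⟨k, rfl⟩ := hj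
      rw [hext_apply]
      exact Nat.lt_succ_iff.mp (m k).isLt
    · rw [hext_off m j hj]
      exact Nat.zero_le _
  let Φ : (κ → Fin (M + 1)) → Torus d ⧸ Torus.subtorus A :=
    fun m => QuotientGroup.mk (E (pt (ext m)))
  have hΦS : Set.range Φ ⊆ (QuotientGroup.mk : Torus d → Torus d ⧸ Torus.subtorus A) '' S := by
    rintro _ ⟨m, rfl⟩
    exact ⟨_, ⟨ext m, hextBox m, rfl⟩, rfl⟩
  have hΦinj : Function.Injective Φ := by
    intro m₁ m₂ h
    have hmem : (E (pt (ext m₁)))⁻¹ * E (pt (ext m₂)) ∈ Torus.subtorus A :=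
      QuotientGroup.eq.mp h
    rw [← expTorus_sub hE, expTorus_mem_subtorus_iff hE] at hmem
    -- the integer vector of the difference lies in `B` and is supported on the range of `a`
    let c : Fin l → ℤ := fun j => (ext m₂ j : ℤ) - (ext m₁ j : ℤ)
    have hψc : ψ c = pt (ext m₂) - pt (ext m₁) := by
      simp only [ψ, Fintype.linearCombination_apply, pt, c]
      rw [← Finset.sum_sub_distrib]
      refine Finset.sum_congr rfl fun j _ => ?_
      rw [← Int.cast_smul_eq_zsmul ℂ, Int.cast_sub, Int.cast_natCast, Int.cast_natCast, sub_smul]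
    have hcB : c ∈ B := by
      rw [hBdef, Submodule.mem_comap, hψc, hY'mem]
      refine ⟨Y.sub_mem (pt_mem _) (pt_mem _), fun u hu => ?_⟩
      obtain ⟨a', ha', rfl⟩ := Submodule.mem_map.mp hu
      exact hmem a' ha'
    have hcsupp : ∀ j, (¬ ∃ k, a k = j) → c j = 0 := fun j hj => by
      simp only [c, hext_off _ j hj, Nat.cast_zero, sub_zero]
    have hc0 := hsep c hcB hcsupp
    funext k
    have hk := hc0 k
    simp only [c, hext_apply] at hk
    exact Fin.ext (by omega)
  have hcount : (M + 1) ^ Fintype.card κ ≤ D ^ r := by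
    calc (M + 1) ^ Fintype.card κ = Nat.card (κ → Fin (M + 1)) := by
          rw [Nat.card_eq_fintype_card, Fintype.card_fun, Fintype.card_fin]
      _ = (Set.range Φ).ncard := (Set.ncard_range_of_injective hΦinj).symm
      _ ≤ ((QuotientGroup.mk : Torus d → Torus d ⧸ Torus.subtorus A) '' S).ncard :=
          Set.ncard_le_ncard hΦS (hSfin.image _)
      _ ≤ D ^ r := hncard
  have hcount' : (M + 1) ^ (l - lam) ≤ D ^ r :=
    (Nat.pow_le_pow_right (Nat.succ_pos M) (by omega : l - lam ≤ Fintype.card κ)).trans hcount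
  -- the real inequality `(N/d)^χ ≤ (M+1)^χ ≤ (M+1)^{(ℓ−λ)/r} ≤ D`
  have hχ0 : (0 : ℝ) ≤ ((chi X Y : ℚ) : ℝ) := by exact_mod_cast chi_nonneg X Y
  have hχ : ((chi X Y : ℚ) : ℝ) ≤ ((l - lam : ℕ) : ℝ) / r := by
    have h : ((chi X Y : ℚ) : ℝ) ≤ ((((l : ℚ) - lam) / r : ℚ) : ℝ) := by exact_mod_cast hchi
    rw [Nat.cast_sub hlaml]
    push_cast at h ⊢
    exact h
  have hb1 : (1 : ℝ) ≤ (M : ℝ) + 1 := by simp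
  have hNd : (N : ℝ) / d ≤ (M : ℝ) + 1 := by
    have hd0 : (0 : ℝ) < d := by exact_mod_cast hd
    rw [div_le_iff₀ hd0]
    have h : N < M * d + d := Nat.lt_div_mul_add hd
    have h' : (N : ℝ) ≤ (M : ℝ) * d + d := by exact_mod_cast h.le
    linarith
  calc ((N : ℝ) / d) ^ ((chi X Y : ℚ) : ℝ)
      ≤ ((M : ℝ) + 1) ^ ((chi X Y : ℚ) : ℝ) := Real.rpow_le_rpow (by positivity) hNd hχ0
    _ ≤ ((M : ℝ) + 1) ^ (((l - lam : ℕ) : ℝ) / r) := Real.rpow_le_rpow_of_exponent_le hb1 hχ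
    _ ≤ D := rpow_div_le_of_pow_le (by positivity) (by positivity) hr1 (by exact_mod_cast hcount')

end Literature.NumberTheory.Transcendental.Waldschmidt1981

end
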